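import Summits.QuantumFields.YangMills.Theorems.UnitScaleTiltFluctuationComparisonRegPrGlobalSlackKernelMatchingCompose
import Summits.QuantumFields.YangMills.Theorems.UnitScaleTiltFluctuationComparisonRegPrGlobalSlackLocalToGlobal
import HarnessLib

/-!
# `UnitScaleTiltFluctuationComparisonRegPrGlobalSlackKernelMatchingOn` — THE K1a PRODUCER CHAIN READ ON A SUB-PREDICATE `S` OF THE WINDOW
# (crux `FluctuationComparisonRegPrIntL`, stmt-QuantumFields-20520 — the interior re-typing of `FluctuationComparisonRegPrL`, stmt-QuantumFields-19935 —
# STUB (i)* `stub_smallBlocksSlackOnChiAll`, odd `L < 7`; width-lever lane B «(R1) print's χ of [Balaban1985UV3] (47) back», seat ym-ust-19935-r1 g2)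

WHY.  The registered small-block stub (i)* of skeleton v5k-B asks KING'S SLACK ROW `PrintChi.GlobalSupRateTSlackOn S (dataOfV3 p π) b₀ p₀ a σ C` only at data `V`
that are `S`-good for BOTH runs, `S :=` print's χ (`PrintChi.ChiGood … ε₀ μ`: the regular minimiser of `V` is history-good with margin `μ` at every height strictly
below `V`).  Lane A's chain for the large-block stub 3⁗ (`…GlobalSlackKernelMatchingCompose` p530624, `…GlobalSlackLocalToGlobal` p530498, capstone
`…GlobalSlackCanonicalEndToEnd` p538799) produces the FULL-window row `GlobalSlack.GlobalSupRateTSlack` from six chart rows, three of which — `RemainderSmallΦ`,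
`CfgSizeΦ`, `CfgCauchyΦ` — quantify over EVERY datum of the sharp `θ(n)`-window; at `L ∈ {3,5}` these three are exactly where the window's edge band bites
(FINDING #44/#56: the background configuration of an edge datum leaves the next window), while on χ-good data the background sits inside every window with margin by
definition.  This file threads a sub-predicate `S K n h V` through the chain: the three configuration-dependent rows are asked only at doubly-`S`-good data, the
three configuration-free rows (`TaylorSplitΦ`, K1a `FlatKernelCauchyΦ`, `KernelSizeΦ`) and the five producer rows (`PintDecompTrivT`, `LocCover`, `LocBlockVolume`,
`LocMatched`, `TermSizeTrivT` — theorems for the canonical polymerisation) are unchanged, and the output is the slack row ON `S` with the SAME `K`-uniform constant.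

CONTENT (every `def` is a hypothesis schema, never asserted; the theorems are lane A's chart calculus with two extra hypotheses carried along — CREDIT: the proof of §2 is
ym-cruxidea-19201-1 g12's (ported by ym-ust-19935-slack g0, p530624) with `S` threaded; nothing of [Balaban1985UV3]/[King1986] is asserted):
* §1 `RemainderSmallΦOn S`, `CfgSizeΦOn S`, `CfgCauchyΦOn S`, `PolymerCauchyMinAtWSlackOn S`, `GlobalSupRateWSlackOn S` + `…_of_full` (full window ⇒ every `S`) and
  antitonicity in `S`;
* §2 `polymerCauchyMinAtWSlackOn_of_charts` — the six rows (three on `S`) ⟹ the local slack row on `S` (`taylor_core_ml` BY NAME at one `(K, n, j, V, Y)`);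
The local→global step on `S` (p530498's counting with `S` threaded) is the sibling file `…GlobalSlackLocalToGlobalOn`; the χ-instance and the registered text of (i)*
are `…GlobalSlackCanonicalOnChi`.

References: C. King, CMP 102 (1986) 649–677 [King1986] (Thm 3.4 (3.9) p.656, (3.12)–(3.13) p.657, Prop. 3.6 (3.56)–(3.57) p.662, (3.72) p.665); T. Bałaban,
CMP 102 (1985) 255–275 [Balaban1985UV3] ((28)–(30) p.263, (43)–(46) pp.266–267, (47) p.267, (57) p.270).
-/

set_option autoImplicit false

noncomputable section

open scoped BigOperators
open Literature.MathematicalPhysics.QuantumFieldTheory.Balaban1983to89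
open Literature.MathematicalPhysics.QuantumFieldTheory.Balaban1983to89.T3ContinuumYM3Torus
open Literature.MathematicalPhysics.QuantumFieldTheory.Balaban1983to89.T3UnitScaleTilt
open Literature.MathematicalPhysics.QuantumFieldTheory.Balaban1983to89.T3LevelShift
open Literature.MathematicalPhysics.QuantumFieldTheory.Balaban1983to89.T3AlphaInputsAC
open Literature.MathematicalPhysics.QuantumFieldTheory.Balaban1983to89.T3AlphaPolymerSocket
open Literature.MathematicalPhysics.QuantumFieldTheory.Balaban1983to89.T3AlphaInputsACTwoRun
open Literature.MathematicalPhysics.QuantumFieldTheory.Balaban1983to89.T3AlphaInputsACTwoRunLevel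
open Summit.QuantumFields.Balaban3D.Proofs.Representation33 (jet26)
open Summit.QuantumFields.YangMills.Theorems.GlobalSlackKernelMatching
open Summit.QuantumFields.YangMills.Theorems.GlobalSlackLocalToGlobal (GlobalSupRateWSlack PolymerCauchyMinAtWSlack)

namespace Summit.QuantumFields.YangMills.Theorems.GlobalSlackKernelMatchingOn

/-- The type of a sub-predicate of the window data (run `K`, height `n ≤ K`, height-`n` field) — the `S` of `PrintChi.GlobalSupRateTSlackOn S` / `PrintChi.TwoSidedRepOn`
(same carrier as `GlobalSlackOn.WinPred`). [cite: Balaban1985UV3, (47) p.267] -/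
abbrev WinPred (F : T3Family) : Type :=
  (K n : ℕ) → n ≤ K → GaugeField (F.P n) 0 (Matrix.specialUnitaryGroup (Fin 2) ℂ) → Prop

/-! ## §1 The configuration-dependent rows and the two slack rows, read on doubly-`S`-good data -/

section Rows

variable {𝕍 : Type} [NormedAddCommGroup 𝕍] [NormedSpace ℂ 𝕍] {F : T3Family} {γ : ℝ}

/-- **REMAINDER ROW ON `S`**: `RemainderSmallΦ` (the rest of `TaylorSplitΦ` for both runs, `θ(n)⁷`-small with the level factor `x⁴`) asked only at window data that are
`S`-good for both runs `K` and `K+1`. [cite: Balaban1985UV3, (57) p.270, (47) p.267] -/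
def RemainderSmallΦOn (S : WinPred F) (D : AlphaDataT3 F γ) (R : RemFam F) (b₀ p₀ κ C_R : ℝ) : Prop :=
  ∀ (K n : ℕ) (h : n ≤ K), ∀ j : ℕ, j < K - n →
    ∀ V : GaugeField (F.P n) 0 (Matrix.specialUnitaryGroup (Fin 2) ℂ), PlaqSmall (θBal F.L γ b₀ p₀ n) V →
      S K n h V → S (K + 1) n (h.trans (Nat.le_succ K)) V →
      ∀ Y ∈ D.Loc K (K - n) (D.triv K (K - n)) (1 + j),
        |R K (K - n) j Y
            (fieldShift (F.sitesPerDir_eq (m := F.m) (K := K) (j := K - n) (m' := F.m) (K' := n) (j' := 0) (by omega)) V)| ≤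
          C_R * Real.exp (-κ * D.treeLen K (1 + j) Y) * θBal F.L γ b₀ p₀ n ^ 7 * (((F.L : ℝ) ^ (K - n - 1 - j))⁻¹) ^ 4 ∧
        |R (K + 1) (K + 1 - n) (j + 1) (refineSet F K Y)
            (fieldShift (F.sitesPerDir_eq (m := F.m) (K := K + 1) (j := K + 1 - n) (m' := F.m) (K' := n) (j' := 0) (by omega)) V)| ≤
          C_R * Real.exp (-κ * D.treeLen K (1 + j) Y) * θBal F.L γ b₀ p₀ n ^ 7 * (((F.L : ℝ) ^ (K - n - 1 - j))⁻¹) ^ 4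

/-- **CONFIGURATION SIZE ROW ON `S`**: `CfgSizeΦ` (sup norm of both runs' chart configurations, `C_s·θ(n)·L^{−2(K−n−1−j)}`) asked only at doubly-`S`-good window data —
for `S :=` print's χ the background configuration is inside every lower window with margin BY DEFINITION. [cite: Balaban1985UV3, (28) p.263, (44) p.267, (47) p.267] -/
def CfgSizeΦOn (S : WinPred F) (D : AlphaDataT3 F γ) (B : CfgFam 𝕍 F) (b₀ p₀ C_s : ℝ) : Prop :=
  ∀ (K n : ℕ) (h : n ≤ K), ∀ j : ℕ, j < K - n →
    ∀ V : GaugeField (F.P n) 0 (Matrix.specialUnitaryGroup (Fin 2) ℂ), PlaqSmall (θBal F.L γ b₀ p₀ n) V →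
      S K n h V → S (K + 1) n (h.trans (Nat.le_succ K)) V →
      ∀ Y ∈ D.Loc K (K - n) (D.triv K (K - n)) (1 + j),
        ‖B K (K - n) j Y
            (fieldShift (F.sitesPerDir_eq (m := F.m) (K := K) (j := K - n) (m' := F.m) (K' := n) (j' := 0) (by omega)) V)‖ ≤
          C_s * θBal F.L γ b₀ p₀ n * (((F.L : ℝ) ^ (K - n - 1 - j))⁻¹) ^ 2 ∧
        ‖(fun c => B (K + 1) (K + 1 - n) (j + 1) (refineSet F K Y)
            (fieldShift (F.sitesPerDir_eq (m := F.m) (K := K + 1) (j := K + 1 - n) (m' := F.m) (K' := n) (j' := 0) (by omega)) V)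
            (matchBond F K j c))‖ ≤
          C_s * θBal F.L γ b₀ p₀ n * (((F.L : ℝ) ^ (K - n - 1 - j))⁻¹) ^ 2

/-- **CONFIGURATION CAUCHY ROW ON `S`, WITH A LOSS `ℓ(n) ≥ 1`**: `CfgCauchyΦ` (the two runs' chart configurations differ by `C_B·θ(n)·L^{−2(K−n−1−j)}·ℓ(n)·L^{−a(1+j)}`;
the 19200-side content in chart currency) asked only at doubly-`S`-good window data. [cite: King1986, Prop. 3.9 (3.71) p.665, (3.72) p.665; Balaban1985UV3, (47) p.267] -/
def CfgCauchyΦOn (S : WinPred F) (D : AlphaDataT3 F γ) (B : CfgFam 𝕍 F) (b₀ p₀ a C_B : ℝ) (ℓ : ℕ → ℝ) : Prop :=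
  ∀ (K n : ℕ) (h : n ≤ K), ∀ j : ℕ, j < K - n →
    ∀ V : GaugeField (F.P n) 0 (Matrix.specialUnitaryGroup (Fin 2) ℂ), PlaqSmall (θBal F.L γ b₀ p₀ n) V →
      S K n h V → S (K + 1) n (h.trans (Nat.le_succ K)) V →
      ∀ Y ∈ D.Loc K (K - n) (D.triv K (K - n)) (1 + j),
        ‖(fun c => B (K + 1) (K + 1 - n) (j + 1) (refineSet F K Y)
              (fieldShift (F.sitesPerDir_eq (m := F.m) (K := K + 1) (j := K + 1 - n) (m' := F.m) (K' := n) (j' := 0) (by omega)) V)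
              (matchBond F K j c)) -
            B K (K - n) j Y
              (fieldShift (F.sitesPerDir_eq (m := F.m) (K := K) (j := K - n) (m' := F.m) (K' := n) (j' := 0) (by omega)) V)‖ ≤
          C_B * θBal F.L γ b₀ p₀ n * (((F.L : ℝ) ^ (K - n - 1 - j))⁻¹) ^ 2 * (ℓ n * (((F.L : ℝ) ^ (1 + j))⁻¹) ^ a)

/-- **THE LOCAL SLACK ROW ON `S`, GENERIC RATE WEIGHT**: `GlobalSlackLocalToGlobal.PolymerCauchyMinAtWSlack` (per-polymer two-cut-off difference with King's additive
slack, budget `C·e^{−κ₁𝓛}·L^{−4(K−n−1−j)}·(w(n)·L^{−a(1+j)} + θ(n)^σ)`) asked only at doubly-`S`-good window data. [cite: King1986, Thm 3.4 (3.9) p.656; Balaban1985UV3, (44) p.267, (47) p.267] -/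
def PolymerCauchyMinAtWSlackOn (S : WinPred F) (D : AlphaDataT3 F γ) (PT : TermFn F) (b₀ p₀ κ₁ : ℝ) (w : ℕ → ℝ) (a : ℝ) (σ : ℕ) (C : ℝ) : Prop :=
  ∃ c : (K n j : ℕ) → Set (Site (F.P K) 0) → ℝ,
    ∀ (K n : ℕ) (h : n ≤ K), ∀ j : ℕ, j < K - n →
      ∀ V : GaugeField (F.P n) 0 (Matrix.specialUnitaryGroup (Fin 2) ℂ), PlaqSmall (θBal F.L γ b₀ p₀ n) V →
        S K n h V → S (K + 1) n (h.trans (Nat.le_succ K)) V →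
        ∀ Y ∈ D.Loc K (K - n) (D.triv K (K - n)) (1 + j),
          |PT (K + 1) (K + 1 - n) (1 + (j + 1)) (refineSet F K Y)
              (fieldShift (F.sitesPerDir_eq (m := F.m) (K := K + 1) (j := K + 1 - n) (m' := F.m) (K' := n) (j' := 0) (by omega)) V) -
            PT K (K - n) (1 + j) Y
              (fieldShift (F.sitesPerDir_eq (m := F.m) (K := K) (j := K - n) (m' := F.m) (K' := n) (j' := 0) (by omega)) V) -
            c K n j Y| ≤
          C * Real.exp (-κ₁ * D.treeLen K (1 + j) Y) * (((F.L : ℝ) ^ (K - n - 1 - j))⁻¹) ^ 4 *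
            (w n * (((F.L : ℝ) ^ (1 + j))⁻¹) ^ a + θBal F.L γ b₀ p₀ n ^ σ)

/-- **THE GLOBAL SLACK ROW ON `S`, GENERIC RATE WEIGHT**: `GlobalSlackLocalToGlobal.GlobalSupRateWSlack` (`|PintH (K+1) n V − PintH K n V − c K n| ≤
C·#Site(F.P n)·(w(n)·L^{−a(K−n)} + θ(n)^σ)`, datum-independent shifts) asked only at doubly-`S`-good window data; at `w n = θ(n)²` it IS `PrintChi.GlobalSupRateTSlackOn S`
(the registered (i)* currency; `Iff.rfl`, sibling file). [cite: King1986, Thm 3.4 (3.9) p.656; Balaban1985UV3, (47) p.267] -/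
def GlobalSupRateWSlackOn (S : WinPred F) (D : AlphaDataT3 F γ) (b₀ p₀ : ℝ) (w : ℕ → ℝ) (a : ℝ) (σ : ℕ) (C : ℝ) : Prop :=
  ∃ c : ℕ → ℕ → ℝ, ∀ (K n : ℕ) (h : n ≤ K) (V : GaugeField (F.P n) 0 (Matrix.specialUnitaryGroup (Fin 2) ℂ)), PlaqSmall (θBal F.L γ b₀ p₀ n) V →
    S K n h V → S (K + 1) n (h.trans (Nat.le_succ K)) V →
    |D.PintH (K + 1) n V - D.PintH K n V - c K n| ≤
      C * (Fintype.card (Site (F.P n) 0) : ℝ) * (w n * (((F.L : ℝ) ^ (K - n))⁻¹) ^ a + θBal F.L γ b₀ p₀ n ^ σ)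

variable {S S' : WinPred F} {D : AlphaDataT3 F γ}

/-- The full-window remainder row implies the row on every `S`. [folklore] -/
theorem remainderSmallΦOn_of_full (S : WinPred F) {R : RemFam F} {b₀ p₀ κ C_R : ℝ} (h : RemainderSmallΦ D R b₀ p₀ κ C_R) :
    RemainderSmallΦOn S D R b₀ p₀ κ C_R :=
  fun K n hn j hj V hV _ _ Y hY => h K n hn j hj V hV Y hY

omit [NormedSpace ℂ 𝕍] in
/-- The full-window configuration size row implies the row on every `S`. [folklore] -/
theorem cfgSizeΦOn_of_full (S : WinPred F) {B : CfgFam 𝕍 F} {b₀ p₀ C_s : ℝ} (h : CfgSizeΦ D B b₀ p₀ C_s) : CfgSizeΦOn S D B b₀ p₀ C_s :=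
  fun K n hn j hj V hV _ _ Y hY => h K n hn j hj V hV Y hY

omit [NormedSpace ℂ 𝕍] in
/-- The full-window configuration Cauchy row implies the row on every `S`. [folklore] -/
theorem cfgCauchyΦOn_of_full (S : WinPred F) {B : CfgFam 𝕍 F} {b₀ p₀ a C_B : ℝ} {ℓ : ℕ → ℝ} (h : CfgCauchyΦ D B b₀ p₀ a C_B ℓ) :
    CfgCauchyΦOn S D B b₀ p₀ a C_B ℓ :=
  fun K n hn j hj V hV _ _ Y hY => h K n hn j hj V hV Y hY

/-- The full-window local slack row implies the row on every `S`. [folklore] -/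
theorem polymerCauchyMinAtWSlackOn_of_full (S : WinPred F) {PT : TermFn F} {b₀ p₀ κ₁ a C : ℝ} {w : ℕ → ℝ} {σ : ℕ}
    (h : PolymerCauchyMinAtWSlack D PT b₀ p₀ κ₁ w a σ C) : PolymerCauchyMinAtWSlackOn S D PT b₀ p₀ κ₁ w a σ C := by
  obtain ⟨c, hc⟩ := h
  exact ⟨c, fun K n hn j hj V hV _ _ Y hY => hc K n hn j hj V hV Y hY⟩

/-- The full-window global slack row implies the row on every `S`. [folklore] -/
theorem globalSupRateWSlackOn_of_full (S : WinPred F) {b₀ p₀ a C : ℝ} {w : ℕ → ℝ} {σ : ℕ} (h : GlobalSupRateWSlack D b₀ p₀ w a σ C) :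
    GlobalSupRateWSlackOn S D b₀ p₀ w a σ C := by
  obtain ⟨c, hc⟩ := h
  exact ⟨c, fun K n hn V hV _ _ => hc K n hn V hV⟩

/-- On the trivial sub-predicate the global row on `S` IS the full-window row. [folklore] -/
theorem globalSupRateWSlackOn_true_iff {b₀ p₀ a C : ℝ} {w : ℕ → ℝ} {σ : ℕ} :
    GlobalSupRateWSlackOn (fun _ _ _ _ => True) D b₀ p₀ w a σ C ↔ GlobalSupRateWSlack D b₀ p₀ w a σ C :=
  ⟨fun ⟨c, hc⟩ => ⟨c, fun K n hn V hV => hc K n hn V hV trivial trivial⟩, globalSupRateWSlackOn_of_full _⟩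

omit [NormedSpace ℂ 𝕍] in
/-- The configuration size row is antitone in `S` (a smaller good set is a weaker row). [folklore] -/
theorem cfgSizeΦOn_mono (hSS' : ∀ K n h V, S K n h V → S' K n h V) {B : CfgFam 𝕍 F} {b₀ p₀ C_s : ℝ} (h : CfgSizeΦOn S' D B b₀ p₀ C_s) :
    CfgSizeΦOn S D B b₀ p₀ C_s :=
  fun K n hn j hj V hV h1 h2 Y hY => h K n hn j hj V hV (hSS' _ _ _ _ h1) (hSS' _ _ _ _ h2) Y hY

omit [NormedSpace ℂ 𝕍] in
/-- The configuration Cauchy row is antitone in `S`. [folklore] -/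
theorem cfgCauchyΦOn_mono (hSS' : ∀ K n h V, S K n h V → S' K n h V) {B : CfgFam 𝕍 F} {b₀ p₀ a C_B : ℝ} {ℓ : ℕ → ℝ}
    (h : CfgCauchyΦOn S' D B b₀ p₀ a C_B ℓ) : CfgCauchyΦOn S D B b₀ p₀ a C_B ℓ :=
  fun K n hn j hj V hV h1 h2 Y hY => h K n hn j hj V hV (hSS' _ _ _ _ h1) (hSS' _ _ _ _ h2) Y hY

/-- The remainder row is antitone in `S`. [folklore] -/
theorem remainderSmallΦOn_mono (hSS' : ∀ K n h V, S K n h V → S' K n h V) {R : RemFam F} {b₀ p₀ κ C_R : ℝ}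
    (h : RemainderSmallΦOn S' D R b₀ p₀ κ C_R) : RemainderSmallΦOn S D R b₀ p₀ κ C_R :=
  fun K n hn j hj V hV h1 h2 Y hY => h K n hn j hj V hV (hSS' _ _ _ _ h1) (hSS' _ _ _ _ h2) Y hY

/-- The global row on `S` is antitone in `S`. [folklore] -/
theorem globalSupRateWSlackOn_mono (hSS' : ∀ K n h V, S K n h V → S' K n h V) {b₀ p₀ a C : ℝ} {w : ℕ → ℝ} {σ : ℕ}
    (h : GlobalSupRateWSlackOn S' D b₀ p₀ w a σ C) : GlobalSupRateWSlackOn S D b₀ p₀ w a σ C := by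
  obtain ⟨c, hc⟩ := h
  exact ⟨c, fun K n hn V hV h1 h2 => hc K n hn V hV (hSS' _ _ _ _ h1) (hSS' _ _ _ _ h2)⟩

end Rows

/-! ## §2 The chart rows compose on `S` (lane A's `polymerCauchyMinAtTSlackW_of_charts`, `S` threaded) -/

section Composition

variable {𝕍 : Type} [NormedAddCommGroup 𝕍] [NormedSpace ℂ 𝕍] {F : T3Family} {γ : ℝ}

/-- **THE K1a INTERFACE COMPOSES ON `S` — weighted form.**  Taylor structure over one chart family + K1a flat-kernel Cauchy + kernel size (configuration-free rows, full)
+ remainder / configuration size / configuration Cauchy with loss `ℓ ≥ 1` ON `S` ⟹ the local two-cut-off row ON `S` with slack `σ = 7`, rate weight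
`w n = θ(n)²·ℓ(n)`, shifts `c := e′ − e`, constant `5·(C_s²C + 6C_sC_BC_E) + 2C_R`, on a window with `(C_s + C_B)·θ(n) ≤ 1` — the chart calculus of
`GlobalSlackKernelMatching.taylor_core_ml` at each doubly-`S`-good `(K, n, j, V, Y)`. [cite: King1986, Prop. 3.6 (3.56)-(3.57) p.662, (3.72) p.665; Balaban1985UV3, (30) p.263, (43)-(44) pp.266-267, (47) p.267, (57) p.270] -/
theorem polymerCauchyMinAtWSlackOn_of_charts (S : WinPred F) {D : AlphaDataT3 F γ} {PT : TermFn F} {Φ : ChartFam 𝕍 F} {e : VacFam F} {B : CfgFam 𝕍 F}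
    {R : RemFam F} {b₀ p₀ κ a C C_E C_R C_s C_B : ℝ} {ℓ : ℕ → ℝ}
    (hC : 0 ≤ C) (hCE : 0 ≤ C_E) (hCR : 0 ≤ C_R) (hCs : 0 ≤ C_s) (hCB : 0 ≤ C_B) (hL : 1 ≤ (F.L : ℝ))
    (hθ0 : ∀ n, 0 ≤ θBal F.L γ b₀ p₀ n) (hθ1 : ∀ n, (C_s + C_B) * θBal F.L γ b₀ p₀ n ≤ 1) (hℓ : ∀ n, 1 ≤ ℓ n)
    (hT : TaylorSplitΦ PT Φ e B R) (hK : FlatKernelCauchyΦ D Φ κ a C) (hE : KernelSizeΦ D Φ κ C_E)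
    (hR : RemainderSmallΦOn S D R b₀ p₀ κ C_R) (hS : CfgSizeΦOn S D B b₀ p₀ C_s) (hBC : CfgCauchyΦOn S D B b₀ p₀ a C_B ℓ) :
    PolymerCauchyMinAtWSlackOn S D PT b₀ p₀ κ (fun n => θBal F.L γ b₀ p₀ n ^ 2 * ℓ n) a 7
      (5 * (C_s ^ 2 * C + 6 * C_s * C_B * C_E) + 2 * C_R) := by
  refine ⟨fun K _ j Y => e (K + 1) (j + 1) (refineSet F K Y) - e K j Y, ?_⟩
  intro K n hn j hj V hV hV₁ hV₂ Y hY
  have hSz := hS K n hn j hj V hV hV₁ hV₂ Y hY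
  have hCy := hBC K n hn j hj V hV hV₁ hV₂ Y hY
  have hRm := hR K n hn j hj V hV hV₁ hV₂ Y hY
  have hEs := hE K (K - n) j Y hY
  rw [hT, hT]
  have hsθ : C_s * θBal F.L γ b₀ p₀ n ≤ 1 := by nlinarith [hθ1 n, hθ0 n]
  have hx0 : 0 ≤ ((F.L : ℝ) ^ (K - n - 1 - j))⁻¹ := by positivity
  have hx1 : ((F.L : ℝ) ^ (K - n - 1 - j))⁻¹ ≤ 1 := inv_le_one_of_one_le₀ (one_le_pow₀ hL)
  have hρ0 : 0 ≤ (((F.L : ℝ) ^ (1 + j))⁻¹) ^ a := Real.rpow_nonneg (by positivity) _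
  have hρ : 0 ≤ ℓ n * (((F.L : ℝ) ^ (1 + j))⁻¹) ^ a := mul_nonneg (zero_le_one.trans (hℓ n)) hρ0
  -- the loss-free kernel row implies the lossy one (`ℓ ≥ 1`)
  have hKc : ∀ d ∈ Finset.Ico 2 7, ‖kerT Φ K j Y d - ker Φ K j Y d‖ ≤
      C * Real.exp (-κ * D.treeLen K (1 + j) Y) * (ℓ n * (((F.L : ℝ) ^ (1 + j))⁻¹) ^ a) := by
    intro d hd
    refine (hK K (K - n) j Y hY d hd).trans ?_
    have hCe : 0 ≤ C * Real.exp (-κ * D.treeLen K (1 + j) Y) := mul_nonneg hC (Real.exp_pos _).le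
    calc C * Real.exp (-κ * D.treeLen K (1 + j) Y) * (((F.L : ℝ) ^ (1 + j))⁻¹) ^ a
        = C * Real.exp (-κ * D.treeLen K (1 + j) Y) * (1 * (((F.L : ℝ) ^ (1 + j))⁻¹) ^ a) := by rw [one_mul]
      _ ≤ C * Real.exp (-κ * D.treeLen K (1 + j) Y) * (ℓ n * (((F.L : ℝ) ^ (1 + j))⁻¹) ^ a) :=
          mul_le_mul_of_nonneg_left (mul_le_mul_of_nonneg_right (hℓ n) hρ0) hCe
  -- run `K+1`'s configuration is the transport of its pull-back
  set B₁ : PBond (F.P K) j → 𝕍 := fun c => B (K + 1) (K + 1 - n) (j + 1) (refineSet F K Y)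
    (fieldShift (F.sitesPerDir_eq (m := F.m) (K := K + 1) (j := K + 1 - n) (m' := F.m) (K' := n) (j' := 0) (by omega)) V)
    (matchBond F K j c) with hB₁
  have hpull : B (K + 1) (K + 1 - n) (j + 1) (refineSet F K Y)
      (fieldShift (F.sitesPerDir_eq (m := F.m) (K := K + 1) (j := K + 1 - n) (m' := F.m) (K' := n) (j' := 0) (by omega)) V) =
      transport 𝕍 F K j B₁ := (transport_pullback K j _).symm
  rw [hpull]
  have key := taylor_core_ml (transport 𝕍 F K j) (Φ K j Y) (Φ (K + 1) (j + 1) (refineSet F K Y)) _ B₁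
    (e K j Y) (e (K + 1) (j + 1) (refineSet F K Y)) _ _
    (hθ0 n) hsθ hx0 hx1 hρ (Real.exp_pos _).le hC hCE hCR hCs hCB hSz.1 hSz.2 hCy hKc hEs hRm.1 hRm.2
  -- reassociate `θ² * (ℓ * ρ₀)` as `(θ² * ℓ) * ρ₀`
  simpa only [mul_assoc] using key

/-- **THE ROW OF RECORD ON `S` (`ℓ ≡ 1`)**: the six rows (three on `S`) ⟹ `PolymerCauchyMinAtWSlackOn S D PT b₀ p₀ κ (θ²) a 7 (5(C_s²C + 6C_sC_BC_E) + 2C_R)`.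
[cite: King1986, Prop. 3.6 p.662, Thm 3.4 (3.9) p.656; Balaban1985UV3, (43)-(44) pp.266-267, (47) p.267] -/
theorem polymerCauchyMinAtTSlackOn_of_charts (S : WinPred F) {D : AlphaDataT3 F γ} {PT : TermFn F} {Φ : ChartFam 𝕍 F} {e : VacFam F} {B : CfgFam 𝕍 F}
    {R : RemFam F} {b₀ p₀ κ a C C_E C_R C_s C_B : ℝ}
    (hC : 0 ≤ C) (hCE : 0 ≤ C_E) (hCR : 0 ≤ C_R) (hCs : 0 ≤ C_s) (hCB : 0 ≤ C_B) (hL : 1 ≤ (F.L : ℝ))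
    (hθ0 : ∀ n, 0 ≤ θBal F.L γ b₀ p₀ n) (hθ1 : ∀ n, (C_s + C_B) * θBal F.L γ b₀ p₀ n ≤ 1)
    (hT : TaylorSplitΦ PT Φ e B R) (hK : FlatKernelCauchyΦ D Φ κ a C) (hE : KernelSizeΦ D Φ κ C_E)
    (hR : RemainderSmallΦOn S D R b₀ p₀ κ C_R) (hS : CfgSizeΦOn S D B b₀ p₀ C_s) (hBC : CfgCauchyΦOn S D B b₀ p₀ a C_B fun _ => 1) :
    PolymerCauchyMinAtWSlackOn S D PT b₀ p₀ κ (fun n => θBal F.L γ b₀ p₀ n ^ 2) a 7 (5 * (C_s ^ 2 * C + 6 * C_s * C_B * C_E) + 2 * C_R) := by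
  obtain ⟨c, hc⟩ := polymerCauchyMinAtWSlackOn_of_charts S hC hCE hCR hCs hCB hL hθ0 hθ1 (fun _ => le_rfl) hT hK hE hR hS hBC
  exact ⟨c, fun K n hn j hj V hV h1 h2 Y hY => by simpa only [mul_one] using hc K n hn j hj V hV h1 h2 Y hY⟩

end Composition

end Summit.QuantumFields.YangMills.Theorems.GlobalSlackKernelMatchingOn

end
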